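import Literature.Analysis.Quadrature.TrapezoidalRulePeriodic
import Literature.Analysis.ValidatedNumerics.MultiPrecisionInterval
import HarnessLib

/-!
# Kernel-checked exponentially convergent trapezoidal rule: enclosures of `∫₀^{2π} v(θ) dθ` for
# periodic analytic integrands by one `decide`

Trunk T-ANA (Analysis/ValidatedNumerics); namespace `Literature.Analysis.ValidatedNumerics.PeriodicTrapezoid`.
Sequel of `Literature/Analysis/Quadrature/TrapezoidalRulePeriodic.lean` (the ANALYSIS, proved there once and for
all: if `f : ℂ → ℂ` is `T`-periodic, holomorphic in the strip `|Im z| < a` and bounded there by `M`, then the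
`N`-point trapezoidal rule satisfies `‖(T/N) Σ_{k<N} f(kT/N) − ∫₀^T f‖ ≤ 2TM/(e^{2πaN/T} − 1)`,
`norm_trapezoidal_sub_integral_le` — Trefethen–Weideman, Thm. 4.2 with (4.16); Davis–Rabinowitz (4.6.5.7) in the
form `2pM/(rⁿ − 1)`, `r = e^{2πa/p}`) and of `MultiPrecisionInterval.lean` (outward-rounded integer interval
arithmetic `MI` / `MC` at a scale `S`, with the kernels `MI.exp`, `MI.pi`, `MC.expI` and their soundness).
THE PROBLEM (Trefethen–Weideman, Sects. 1, 4, 5): for a `2π`-periodic integrand analytic in a strip the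
trapezoidal rule converges geometrically, `|I_N − I| = O(e^{−aN})`, and the error bound is EXPLICIT once a
strip half-width `a` and a bound `M` of `|v|` on the strip are known (op. cit. Sect. 5: for `e^{cos θ}`,
`|v| ≤ e^{cosh a}` and `|I_N − I| ≤ 4π e^{cosh a}/(e^{aN} − 1)` for every `a > 0`).  To turn this into a
CERTIFICATE one needs (i) a certified `M` for the chosen strip — including the guarantee that the continuation
of `v` IS holomorphic there (no zero of a denominator, no branch point of a square root) — and (ii) a rigorous
evaluation of the finite sum `I_N`.  Nothing in this directory did either for periodic integrands (the
`TaylorModelIntegralCert*` files integrate panel Taylor models at algebraic order; `MonotoneQuadrature` is a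
zeroth-order Riemann bracket); this module supplies both, for a code list of integrands, in four parts:

* Part A — SYNTAX AND SEMANTICS: `SExpr` (rational constants, the harmonics `cos mθ`, `sin mθ`, and
  `+ − × exp cos sin ⁻¹ √`), its complex semantics `evalC` (principal `√`), its real semantics `evalR`,
  `2π`-periodicity on `ℂ` (`evalC_add_two_pi`).
* Part B — THE CERTIFIED STRIP MAJORANT, a rational "strip-bound arithmetic": the strip is parametrised by a
  RATIONAL `r > 1`, `a = log r`, so that `e^{aN} = r^N` and `sup_{|Im z|<a} |cos mz| ≤ cosh(ma) = (r^m + r^{−m})/2`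
  are rational; `bnd r e : SB = (ub, lb, relo, rehi)` propagates an upper bound of `|w|`, a lower bound of `|w|`
  and a range of `Re w` for the value `w` of every subexpression over the strip (`e^x ≤ (68/25)^⌈x⌉`, `|cos w|,
  |sin w| ≤ cosh |w|`, `|w⁻¹| ≤ 1/lb`, `|√w| ≤ (1 + |w|)/2`, `Re √w ≥ min(max(lb, relo), 1)`), and the side
  conditions `ok r e` (every reciprocal has `lb > 0`, every radicand `relo > 0`, decided over `ℚ`) make the
  continuation holomorphic: `sbnd_evalC` (ONE induction: `ok r e → |Im z| < log r → SBnd (evalC e z) (bnd r e) ∧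
  DifferentiableAt ℂ (evalC e) z`), `differentiableOn_evalC`, `norm_evalC_le`, and `evalC_ofReal` (on the real
  axis the complex semantics is the real one, `Complex.ofReal_cpow` needing the certified `relo > 0`).
* Part C — THE ERROR THEOREM in `r`-form: `abs_trapezoid_sub_integral_le`
  (`ok r e`, `N ≠ 0`: `|(2π/N) Σ_{k<N} v(2πk/N) − ∫₀^{2π} v| ≤ 4π·ub/(r^N − 1)`), the anchor theorem
  instantiated with `T = 2π`, `a = log r`, `M = (bnd r e).ub` and transported to `ℝ`.
* Part D — THE KERNEL: the interval evaluator `evalMI S K k piI E e` of `v(θ)` from a box `E ∋ e^{iθ}` (the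
  harmonics are the powers of `E`, `powE`; `MI.exp`, `MC.expI` for `exp cos sin`; a sign-tested reciprocal
  `invI`; a SELF-VALIDATING square root `sqrtI` — integer Newton candidates CHECKED against their defining
  inequalities, so no property of the iteration is proved), `mem_evalMI` (the fundamental theorem of interval
  arithmetic for the code list); the nodes `node piI N j ∋ 2πj/N` and the folded sum `trapSum` (`mem_trapSum`);
  the certificate data `trapData` (`I_N·S` and `4π·ub/(r^N − 1)·S` as intervals) and the Boolean CERTIFICATE
  `trapCheck e r S K k N lo hi` (integer arithmetic only); MAIN THEOREM `integral_mem_of_trapCheck`: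
  `trapCheck … = true → lo ≤ ∫₀^{2π} evalR e θ dθ ≤ hi`, hypothesis-free but for the Boolean, which the kernel
  decides.

Parameters (all chosen by the untrusted proposer; any values that pass are sound): `r` just below `e^{a₀}`, `a₀`
the distance from the real axis to the nearest singularity of the continuation (a too large `r` simply fails
`ok`); the error radius `4π·ub/(r^N − 1)` loses `log₁₀(4π·ub)` digits to the growth of `M` and gains `N log₁₀ r`;
the scale `S ≈ 10^{digits+12}`; `K ≥ 0.22 log₂ S` (`K` terms of Machin's series for `π` and of the Taylor
kernels), `k ≈ 8` argument halvings (each costs one bit of the interval width).  Kernel cost is linear in `N`: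
about `0.2 s` per node at `S = 2²⁵⁶`, `K = 60` on the farm.

Worked end to end (scratch kept OUT of the tree, `Certquad.ScratchTrapezoid`, one file on top of this module;
`132 s` on the farm for all five certificates, `588` nodes, `S = 2²⁵⁶`, `K = 60`, `k = 8`), each by ONE
`decide +kernel` of `trapCheck` followed by `simp only [evalR]; push_cast` to display the integrand:
`∫₀^{2π} e^{cos θ} dθ` (`= 2π I₀(1)`; `r = 88`, `N = 44`) to width `2.6·10⁻⁶⁵`; `∫₀^{2π} dθ/(2 + cos θ)`
(`= 2π/√3`; poles at `π ± i log(2 + √3)`; `r = 7/2`, `N = 120`) to `1.2·10⁻⁶³`; the Poisson integral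
`∫₀^{2π} cos 3θ/(5/4 − cos θ) dθ` (`= π/3`; poles at `±i log 2`; `r = 19/10`, `N = 240`) to `3.0·10⁻⁶⁴`; the
perimeter integral `∫₀^{2π} √(1 − (9/25) sin²θ) dθ` (`= 4E(3/5)`; branch points at `π/2 ± i log 3`, Trefethen–
Weideman's opening example with rate `3^{−N}`; `r = 29/10`, `N = 140`) to `6.8·10⁻⁶⁴`; `∫₀^{2π} cos(sin θ) dθ`
(`= 2π J₀(1)`; `r = 88`, `N = 44`) to `1.4·10⁻⁶⁵`.  The closed forms are NOT used or proved; reference values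
computed independently (power series of `I₀`, `J₀`, the AGM for `E`, 90 digits) lie inside every bracket.  The same
code list covers `J_n(x)`, `I_n(x)` at rational `x` (`cos(nθ − x sin θ) = cos nθ cos(x sin θ) + sin nθ sin(x sin θ)`),
the complete elliptic integrals `K`, `E` at rational modulus, and Poisson / Fourier-coefficient integrals of
functions in the list.

Honest framing.  These are shared numerical engines serving client cells; rigour lives in the verifiers (the
soundness theorems below, whose only hypothesis is a Boolean certificate decided by the kernel); every published
number belongs to a client cell's ledger, not to the engines group.  ANCHOR / nearest in-tree relatives:
`Quadrature.TrapezoidalRulePeriodic` (USED: `norm_trapezoidal_sub_integral_le` — all the complex analysis is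
there), `MultiPrecisionInterval` (USED: `MI.add/neg/sub/mul/mulInt/divNat/divPos/ofInt/ofFrac/exp/pi`, `MC.mul/
ofInt/expI` and their `mem_*`), `Quadrature.TrapezoidalRuleRealLine` / `TanhSinhTransformation` (the real-line and
double-exponential variants, analysis only — not bridged), `Quadrature.GaussLegendreAnalytic` (the analogous
ellipse bound for Gauss–Legendre — irrational nodes, not bridged), `TaylorModelIntegralCert*` (non-periodic
integrands, algebraic order).  Nearest prior art in print: the Petras–Johansson rigorous integrator of Arb
(adaptive Gauss–Legendre with magnitude bounds `M` obtained by EVALUATING `f` in ball arithmetic on an ellipse;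
not kernel-checked) and CoqInterval's verified polynomial-approximation quadrature (formally verified, algebraic
order); here `M` comes instead from a symbolic rational majorant calculus, so that the error term is a closed-form
rational and the only interval evaluations are at the `N` real nodes.  Deliberately NOT here: non-periodic
integrands and endpoint singularities (periodising transformations are not formalised), the real-line rule,
adaptivity and the optimal choice of `r, N` (the proposer's business), integrands outside the code list (`log`,
`tan`, general powers, special functions: add a constructor with its `SBnd` and `evalMI` clauses), complex-valued
integrals, and any floating-point arithmetic (all certificate data are exact rationals and scaled integers).
Problem-independent; no facts, no axioms; all certificate data computable over `ℚ` and `ℤ`.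

References: [cite: TrefethenWeideman2014, Thm. 4.2]; [cite: TrefethenWeideman2014, Sect. 5 (5.2)];
[cite: TrefethenWeideman2014, Sect. 4 (4.2)]; [cite: DavisRabinowitz1984, Sect. 4.6.5 (4.6.5.7)];
[cite: Moore1979, Thm. 3.1]; [cite: Moore1979, Sect. 3.3]; [cite: Moore1979, Sect. 4.4 (4.11)];
[cite: Moore1979, Sect. 4.4 (4.12)]; [cite: Johansson2018, Sect. 2]; [cite: MahboubiMelquiondSibutpinote2016, Sect. 4.1].

AI-produced formalisation (H21 engines group, seat eng-quad-3 gen 60, 2026-08-23); no facts, no axioms, no `sorry`.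
-/

open scoped Real

namespace Literature.Analysis.ValidatedNumerics

namespace PeriodicTrapezoid

open Literature.Analysis.ValidatedNumerics.NumericsMP

/-! ### Part A. Trigonometric expressions: syntax, complex and real semantics, periodicity -/

/-- The integrand language: closed `2π`-periodic expressions built from rational constants and the
harmonics `cos mθ`, `sin mθ` by `+ − × exp cos sin`, reciprocal and square root — a code list of
unary standard functions and binary arithmetic operations in the sense of interval analysis.
[cite: Moore1979, Sect. 4.4 (4.11)] -/
inductive SExpr : Type
  | const (c : ℚ)
  | cosN (m : ℕ)
  | sinN (m : ℕ)
  | add (e f : SExpr)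
  | sub (e f : SExpr)
  | neg (e : SExpr)
  | mul (e f : SExpr)
  | exp (e : SExpr)
  | cos (e : SExpr)
  | sin (e : SExpr)
  | inv (e : SExpr)
  | sqrt (e : SExpr)

/-- Complex semantics (the analytic continuation of the integrand into the strip): `√w` is the
principal branch `w ^ (1/2)`. [cite: TrefethenWeideman2014, Thm. 4.2] -/
noncomputable def evalC : SExpr → ℂ → ℂ
  | .const c => fun _ => (c : ℂ)
  | .cosN m => fun z => Complex.cos ((m : ℂ) * z)
  | .sinN m => fun z => Complex.sin ((m : ℂ) * z)
  | .add e f => fun z => evalC e z + evalC f z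
  | .sub e f => fun z => evalC e z - evalC f z
  | .neg e => fun z => -evalC e z
  | .mul e f => fun z => evalC e z * evalC f z
  | .exp e => fun z => Complex.exp (evalC e z)
  | .cos e => fun z => Complex.cos (evalC e z)
  | .sin e => fun z => Complex.sin (evalC e z)
  | .inv e => fun z => (evalC e z)⁻¹
  | .sqrt e => fun z => evalC e z ^ (((1 : ℝ) / 2 : ℝ) : ℂ)

/-- Real semantics: the integrand `θ ↦ v(θ)` on the real axis. [cite: TrefethenWeideman2014, Thm. 4.2] -/
noncomputable def evalR : SExpr → ℝ → ℝ
  | .const c, _ => (c : ℝ)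
  | .cosN m, θ => Real.cos (m * θ)
  | .sinN m, θ => Real.sin (m * θ)
  | .add e f, θ => evalR e θ + evalR f θ
  | .sub e f, θ => evalR e θ - evalR f θ
  | .neg e, θ => -evalR e θ
  | .mul e f, θ => evalR e θ * evalR f θ
  | .exp e, θ => Real.exp (evalR e θ)
  | .cos e, θ => Real.cos (evalR e θ)
  | .sin e, θ => Real.sin (evalR e θ)
  | .inv e, θ => (evalR e θ)⁻¹
  | .sqrt e, θ => Real.sqrt (evalR e θ)

/-- Every expression is `2π`-periodic as a function on `ℂ`. [cite: TrefethenWeideman2014, Thm. 4.2] -/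
theorem evalC_add_two_pi (e : SExpr) (z : ℂ) : evalC e (z + 2 * π) = evalC e z := by
  induction e with
  | const c => simp only [evalC]
  | cosN m =>
    simp only [evalC]
    rw [mul_add]
    exact Complex.cos_add_nat_mul_two_pi _ _
  | sinN m =>
    simp only [evalC]
    rw [mul_add]
    exact Complex.sin_add_nat_mul_two_pi _ _
  | add e f ihe ihf => simp only [evalC, ihe, ihf]
  | sub e f ihe ihf => simp only [evalC, ihe, ihf]
  | neg e ih => simp only [evalC, ih]
  | mul e f ihe ihf => simp only [evalC, ihe, ihf]
  | exp e ih => simp only [evalC, ih]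
  | cos e ih => simp only [evalC, ih]
  | sin e ih => simp only [evalC, ih]
  | inv e ih => simp only [evalC, ih]
  | sqrt e ih => simp only [evalC, ih]

/-! ### Part B. A strip majorant calculus: certified bounds `lb ≤ |v(z)| ≤ ub`, `relo ≤ Re v(z) ≤ rehi`
on `|Im z| < log r` -/

/-- Certified strip data of an expression for the strip `|Im z| < log r`: an upper bound `ub` and a
lower bound `lb` of `|v(z)|` and an enclosure `[relo, rehi]` of `Re v(z)`, all rational.
[cite: TrefethenWeideman2014, Sect. 5 (5.2)] -/
structure SB where
  /-- upper bound of `‖v z‖` on the strip -/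
  ub : ℚ
  /-- lower bound of `‖v z‖` on the strip -/
  lb : ℚ
  /-- lower bound of `Re (v z)` on the strip -/
  relo : ℚ
  /-- upper bound of `Re (v z)` on the strip -/
  rehi : ℚ
  deriving Repr

/-- The soundness predicate of strip data at one point. [cite: Moore1979, Thm. 3.1] -/
structure SBnd (v : ℂ) (B : SB) : Prop where
  norm_le : ‖v‖ ≤ (B.ub : ℝ)
  le_norm : (B.lb : ℝ) ≤ ‖v‖
  le_re : (B.relo : ℝ) ≤ v.re
  re_le : v.re ≤ (B.rehi : ℝ)

/-- `cosh (m log r) = (r^m + r^{-m})/2`, the maximum of `|cos mz|`, `|sin mz|` on `|Im z| ≤ log r`.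
[cite: TrefethenWeideman2014, Sect. 5 (5.2)] -/
def coshQ (r : ℚ) (m : ℕ) : ℚ := (r ^ m + (r ^ m)⁻¹) / 2

/-- A rational upper bound of `e^x` for `x ≤ q`: `(68/25)^⌈q⌉`. [cite: Moore1979, Sect. 3.3] -/
def expUb (q : ℚ) : ℚ := (68 / 25 : ℚ) ^ ⌈q⌉₊

namespace SB

/-- Strip data of a sum. [cite: Moore1979, Sect. 3.3] -/
def addB (A B : SB) : SB :=
  ⟨A.ub + B.ub,
    max (max (A.lb - B.ub) (B.lb - A.ub)) (max (A.relo + B.relo) (-(A.rehi + B.rehi))),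
    A.relo + B.relo, A.rehi + B.rehi⟩

/-- Strip data of a negation. [cite: Moore1979, Sect. 3.3] -/
def negB (A : SB) : SB := ⟨A.ub, A.lb, -A.rehi, -A.relo⟩

/-- Strip data of a difference. [cite: Moore1979, Sect. 3.3] -/
def subB (A B : SB) : SB := addB A (negB B)

/-- Strip data of a product. [cite: Moore1979, Sect. 3.3] -/
def mulB (A B : SB) : SB :=
  ⟨A.ub * B.ub, max A.lb 0 * max B.lb 0, -(A.ub * B.ub), A.ub * B.ub⟩

/-- Strip data of `exp v`: `|e^v| = e^{Re v}`. [cite: TrefethenWeideman2014, Sect. 5 (5.2)] -/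
def expB (A : SB) : SB :=
  ⟨expUb A.rehi, (expUb (-A.relo))⁻¹, -expUb A.rehi, expUb A.rehi⟩

/-- Strip data of `cos v` and `sin v`: `|cos v|, |sin v| ≤ cosh |Im v| ≤ cosh |v| ≤ (e^{ub} + 1)/2`.
[cite: TrefethenWeideman2014, Sect. 5 (5.2)] -/
def trigB (A : SB) : SB :=
  ⟨(expUb A.ub + 1) / 2, 0, -((expUb A.ub + 1) / 2), (expUb A.ub + 1) / 2⟩

/-- Strip data of `1/v` (meaningful when `A.lb > 0`). [cite: Moore1979, Sect. 3.3] -/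
def invB (A : SB) : SB := ⟨A.lb⁻¹, A.ub⁻¹, -A.lb⁻¹, A.lb⁻¹⟩

/-- Strip data of the principal `√v` (meaningful when `A.relo > 0`): `√u ≤ (1 + u)/2`,
`√u ≥ min (u, 1)`, `Re √v ≥ 0`. [cite: Moore1979, Sect. 3.3] -/
def sqrtB (A : SB) : SB := ⟨(1 + A.ub) / 2, min (max A.lb A.relo) 1, 0, (1 + A.ub) / 2⟩

end SB

/-- The strip data of an expression for the strip `|Im z| < log r` (`r > 1` rational), by
structural recursion. [cite: TrefethenWeideman2014, Sect. 5 (5.2)] -/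
def bnd (r : ℚ) : SExpr → SB
  | .const c => ⟨|c|, |c|, c, c⟩
  | .cosN m => ⟨coshQ r m, 0, -coshQ r m, coshQ r m⟩
  | .sinN m => ⟨coshQ r m, 0, -coshQ r m, coshQ r m⟩
  | .add e f => (bnd r e).addB (bnd r f)
  | .sub e f => (bnd r e).subB (bnd r f)
  | .neg e => (bnd r e).negB
  | .mul e f => (bnd r e).mulB (bnd r f)
  | .exp e => (bnd r e).expB
  | .cos e => (bnd r e).trigB
  | .sin e => (bnd r e).trigB
  | .inv e => (bnd r e).invB
  | .sqrt e => (bnd r e).sqrtB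

/-- The side conditions under which the strip data are sound and the expression is analytic in the
strip: every reciprocal has a certified positive lower bound of `|v|`, every square root a certified
positive lower bound of `Re v` (no division by an interval containing `0`, the radicand stays in the
slit plane). [cite: Moore1979, Sect. 4.4 (4.12)] -/
def ok (r : ℚ) : SExpr → Bool
  | .const _ => true
  | .cosN _ => true
  | .sinN _ => true
  | .add e f => ok r e && ok r f
  | .sub e f => ok r e && ok r f
  | .neg e => ok r e
  | .mul e f => ok r e && ok r f
  | .exp e => ok r e
  | .cos e => ok r e
  | .sin e => ok r e
  | .inv e => ok r e && decide (0 < (bnd r e).lb)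
  | .sqrt e => ok r e && decide (0 < (bnd r e).relo)

/-! #### Soundness of the combinators -/

/-- `|cos w| ≤ cosh (Im w)`. [folklore] -/
private theorem norm_cos_le_cosh_im (w : ℂ) : ‖Complex.cos w‖ ≤ Real.cosh w.im := by
  have h1 : ‖Complex.exp (w * Complex.I)‖ = Real.exp (-w.im) := by
    rw [Complex.norm_exp]
    congr 1
    simp [Complex.mul_re]
  have h2 : ‖Complex.exp (-w * Complex.I)‖ = Real.exp w.im := by
    rw [Complex.norm_exp]
    congr 1
    simp [Complex.mul_re]
  have hcos : Complex.cos w = (Complex.exp (w * Complex.I) + Complex.exp (-w * Complex.I)) / 2 := rfl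
  rw [hcos, norm_div, Complex.norm_two, Real.cosh_eq]
  gcongr
  calc ‖Complex.exp (w * Complex.I) + Complex.exp (-w * Complex.I)‖
      ≤ ‖Complex.exp (w * Complex.I)‖ + ‖Complex.exp (-w * Complex.I)‖ := norm_add_le _ _
    _ = Real.exp w.im + Real.exp (-w.im) := by rw [h1, h2, add_comm]

/-- `|sin w| ≤ cosh (Im w)`. [folklore] -/
private theorem norm_sin_le_cosh_im (w : ℂ) : ‖Complex.sin w‖ ≤ Real.cosh w.im := by
  have h1 : ‖Complex.exp (w * Complex.I)‖ = Real.exp (-w.im) := by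
    rw [Complex.norm_exp]
    congr 1
    simp [Complex.mul_re]
  have h2 : ‖Complex.exp (-w * Complex.I)‖ = Real.exp w.im := by
    rw [Complex.norm_exp]
    congr 1
    simp [Complex.mul_re]
  have hsin : Complex.sin w =
      (Complex.exp (-w * Complex.I) - Complex.exp (w * Complex.I)) * Complex.I / 2 := rfl
  rw [hsin, norm_div, norm_mul, Complex.norm_I, mul_one, Complex.norm_two, Real.cosh_eq]
  gcongr
  calc ‖Complex.exp (-w * Complex.I) - Complex.exp (w * Complex.I)‖
      ≤ ‖Complex.exp (-w * Complex.I)‖ + ‖Complex.exp (w * Complex.I)‖ := norm_sub_le _ _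
    _ = Real.exp w.im + Real.exp (-w.im) := by rw [h1, h2]

/-- `cosh` is monotone in `|·|`. [folklore] -/
private theorem cosh_le_cosh_of_abs_le {x t : ℝ} (h : |x| ≤ t) : Real.cosh x ≤ Real.cosh t :=
  Real.cosh_le_cosh.mpr (h.trans (le_abs_self t))

/-- Strip data from a norm enclosure alone. [folklore] -/
private theorem sbnd_of_norm {v : ℂ} {U L : ℚ} (hU : ‖v‖ ≤ (U : ℝ)) (hL : (L : ℝ) ≤ ‖v‖) :
    SBnd v ⟨U, L, -U, U⟩ where
  norm_le := hU
  le_norm := hL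
  le_re := by
    have h := Complex.abs_re_le_norm v
    rw [abs_le] at h
    push_cast
    linarith [h.1]
  re_le := by
    have h := Complex.abs_re_le_norm v
    rw [abs_le] at h
    linarith [h.2]

/-- `e^x ≤ expUb q` for `x ≤ q`. [folklore] -/
private theorem exp_le_expUb {x : ℝ} {q : ℚ} (h : x ≤ q) : Real.exp x ≤ ((expUb q : ℚ) : ℝ) := by
  unfold expUb
  push_cast
  have hq : (q : ℝ) ≤ ((⌈q⌉₊ : ℕ) : ℝ) := by exact_mod_cast Nat.le_ceil q
  have he : Real.exp 1 ≤ (68 / 25 : ℝ) := by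
    have := Real.exp_one_lt_d9
    norm_num at this ⊢
    linarith
  calc Real.exp x ≤ Real.exp ((⌈q⌉₊ : ℕ) : ℝ) := Real.exp_le_exp.mpr (h.trans hq)
    _ = Real.exp 1 ^ ⌈q⌉₊ := by rw [← Real.exp_nat_mul, mul_one]
    _ ≤ (68 / 25 : ℝ) ^ ⌈q⌉₊ := pow_le_pow_left₀ (Real.exp_pos 1).le he _

/-- `0 < expUb q`. [folklore] -/
private theorem expUb_pos (q : ℚ) : (0 : ℝ) < ((expUb q : ℚ) : ℝ) := by
  unfold expUb
  push_cast
  positivity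

/-- Soundness of the strip data of a constant. [cite: Moore1979, Thm. 3.1] -/
theorem SBnd.const (c : ℚ) : SBnd (c : ℂ) ⟨|c|, |c|, c, c⟩ where
  norm_le := by rw [Complex.norm_ratCast]; push_cast; exact le_rfl
  le_norm := by rw [Complex.norm_ratCast]; push_cast; exact le_rfl
  le_re := by simp
  re_le := by simp

/-- Soundness of `addB`. [cite: Moore1979, Thm. 3.1] -/
theorem SBnd.add {z w : ℂ} {A B : SB} (hz : SBnd z A) (hw : SBnd w B) :
    SBnd (z + w) (A.addB B) where
  norm_le := by
    simp only [SB.addB]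
    push_cast
    exact (norm_add_le z w).trans (add_le_add hz.norm_le hw.norm_le)
  le_norm := by
    simp only [SB.addB]
    push_cast
    have h1 : ‖z‖ ≤ ‖z + w‖ + ‖w‖ := norm_le_add_norm_add z w
    have h2 : ‖w‖ ≤ ‖z + w‖ + ‖z‖ := norm_le_add_norm_add' z w
    have h4 := Complex.abs_re_le_norm (z + w)
    rw [abs_le, Complex.add_re] at h4
    have := hz.norm_le; have := hw.norm_le; have := hz.le_norm; have := hw.le_norm
    have := hz.le_re; have := hw.le_re; have := hz.re_le; have := hw.re_le
    refine max_le (max_le ?_ ?_) (max_le ?_ ?_) <;> linarith [h4.1, h4.2]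
  le_re := by
    simp only [SB.addB, Complex.add_re]
    push_cast
    linarith [hz.le_re, hw.le_re]
  re_le := by
    simp only [SB.addB, Complex.add_re]
    push_cast
    linarith [hz.re_le, hw.re_le]

/-- Soundness of `negB`. [cite: Moore1979, Thm. 3.1] -/
theorem SBnd.neg {z : ℂ} {A : SB} (hz : SBnd z A) : SBnd (-z) A.negB where
  norm_le := by simp only [SB.negB, norm_neg]; exact hz.norm_le
  le_norm := by simp only [SB.negB, norm_neg]; exact hz.le_norm
  le_re := by simp only [SB.negB, Complex.neg_re]; push_cast; linarith [hz.re_le]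
  re_le := by simp only [SB.negB, Complex.neg_re]; push_cast; linarith [hz.le_re]

/-- Soundness of `subB`. [cite: Moore1979, Thm. 3.1] -/
theorem SBnd.sub {z w : ℂ} {A B : SB} (hz : SBnd z A) (hw : SBnd w B) :
    SBnd (z - w) (A.subB B) := by
  rw [sub_eq_add_neg]
  exact hz.add hw.neg

/-- Soundness of `mulB`. [cite: Moore1979, Thm. 3.1] -/
theorem SBnd.mul {z w : ℂ} {A B : SB} (hz : SBnd z A) (hw : SBnd w B) :
    SBnd (z * w) (A.mulB B) := by
  have hU : ‖z * w‖ ≤ ((A.ub * B.ub : ℚ) : ℝ) := by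
    rw [norm_mul]
    push_cast
    exact mul_le_mul hz.norm_le hw.norm_le (norm_nonneg w)
      ((norm_nonneg z).trans hz.norm_le)
  have hL : ((max A.lb 0 * max B.lb 0 : ℚ) : ℝ) ≤ ‖z * w‖ := by
    rw [norm_mul]
    push_cast
    exact mul_le_mul (max_le hz.le_norm (norm_nonneg z)) (max_le hw.le_norm (norm_nonneg w))
      (le_max_right _ _) (norm_nonneg z)
  exact sbnd_of_norm hU hL

/-- Soundness of `expB`. [cite: Moore1979, Thm. 3.1] -/
theorem SBnd.exp {z : ℂ} {A : SB} (hz : SBnd z A) : SBnd (Complex.exp z) A.expB := by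
  have hU : ‖Complex.exp z‖ ≤ ((expUb A.rehi : ℚ) : ℝ) := by
    rw [Complex.norm_exp]
    exact exp_le_expUb hz.re_le
  have hL : (((expUb (-A.relo))⁻¹ : ℚ) : ℝ) ≤ ‖Complex.exp z‖ := by
    rw [Complex.norm_exp, Rat.cast_inv]
    have h1 : Real.exp (-z.re) ≤ ((expUb (-A.relo) : ℚ) : ℝ) :=
      exp_le_expUb (by push_cast; linarith [hz.le_re])
    have h2 := inv_anti₀ (Real.exp_pos _) h1
    rwa [Real.exp_neg, inv_inv] at h2
  exact sbnd_of_norm hU hL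

/-- `|cos z|, |sin z| ≤ (expUb ub + 1)/2` from `‖z‖ ≤ ub`. [folklore] -/
private theorem cosh_im_le_trig {z : ℂ} {A : SB} (hz : SBnd z A) :
    Real.cosh z.im ≤ (((expUb A.ub + 1) / 2 : ℚ) : ℝ) := by
  have hU : (0 : ℝ) ≤ A.ub := (norm_nonneg z).trans hz.norm_le
  have h1 : Real.cosh z.im ≤ Real.cosh (A.ub : ℝ) :=
    cosh_le_cosh_of_abs_le ((Complex.abs_im_le_norm z).trans hz.norm_le)
  have h2 : Real.exp (A.ub : ℝ) ≤ ((expUb A.ub : ℚ) : ℝ) := exp_le_expUb le_rfl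
  have h3 : Real.exp (-(A.ub : ℝ)) ≤ 1 := by
    rw [Real.exp_le_one_iff]
    linarith
  have h4 : Real.cosh (A.ub : ℝ) = (Real.exp (A.ub : ℝ) + Real.exp (-(A.ub : ℝ))) / 2 :=
    Real.cosh_eq _
  push_cast
  linarith

/-- Soundness of `trigB` for `cos`. [cite: Moore1979, Thm. 3.1] -/
theorem SBnd.cos {z : ℂ} {A : SB} (hz : SBnd z A) : SBnd (Complex.cos z) A.trigB :=
  sbnd_of_norm ((norm_cos_le_cosh_im z).trans (cosh_im_le_trig hz))
    (by push_cast; exact norm_nonneg _)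

/-- Soundness of `trigB` for `sin`. [cite: Moore1979, Thm. 3.1] -/
theorem SBnd.sin {z : ℂ} {A : SB} (hz : SBnd z A) : SBnd (Complex.sin z) A.trigB :=
  sbnd_of_norm ((norm_sin_le_cosh_im z).trans (cosh_im_le_trig hz))
    (by push_cast; exact norm_nonneg _)

/-- Soundness of `invB` under `0 < lb`. [cite: Moore1979, Thm. 3.1] -/
theorem SBnd.inv {z : ℂ} {A : SB} (hz : SBnd z A) (hlb : 0 < A.lb) : SBnd z⁻¹ A.invB := by
  have hlb' : (0 : ℝ) < A.lb := by exact_mod_cast hlb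
  have hzpos : 0 < ‖z‖ := hlb'.trans_le hz.le_norm
  have hU : ‖z⁻¹‖ ≤ ((A.lb⁻¹ : ℚ) : ℝ) := by
    rw [norm_inv, Rat.cast_inv]
    exact inv_anti₀ hlb' hz.le_norm
  have hL : ((A.ub⁻¹ : ℚ) : ℝ) ≤ ‖z⁻¹‖ := by
    rw [norm_inv, Rat.cast_inv]
    exact inv_anti₀ hzpos hz.norm_le
  exact sbnd_of_norm hU hL

/-- A point with certified positive `lb` is nonzero. [folklore] -/
private theorem ne_zero_of_lb {z : ℂ} {A : SB} (hz : SBnd z A) (hlb : 0 < A.lb) : z ≠ 0 := by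
  have hlb' : (0 : ℝ) < A.lb := by exact_mod_cast hlb
  exact norm_pos_iff.mp (hlb'.trans_le hz.le_norm)

/-- A point with certified positive `relo` lies in the slit plane. [folklore] -/
private theorem mem_slitPlane_of_relo {z : ℂ} {A : SB} (hz : SBnd z A) (h : 0 < A.relo) :
    z ∈ Complex.slitPlane := by
  have h' : (0 : ℝ) < A.relo := by exact_mod_cast h
  exact Complex.mem_slitPlane_iff.mpr (Or.inl (h'.trans_le hz.le_re))

/-- Soundness of `sqrtB` under `0 < relo`. [cite: Moore1979, Thm. 3.1] -/
theorem SBnd.sqrt {z : ℂ} {A : SB} (hz : SBnd z A) (h : 0 < A.relo) :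
    SBnd (z ^ (((1 : ℝ) / 2 : ℝ) : ℂ)) A.sqrtB := by
  have hnorm : ‖z ^ (((1 : ℝ) / 2 : ℝ) : ℂ)‖ = Real.sqrt ‖z‖ := by
    rw [Complex.norm_cpow_real, Real.sqrt_eq_rpow]
  have hU0 : (0 : ℝ) ≤ A.ub := (norm_nonneg z).trans hz.norm_le
  have hU : ‖z ^ (((1 : ℝ) / 2 : ℝ) : ℂ)‖ ≤ (((1 + A.ub) / 2 : ℚ) : ℝ) := by
    rw [hnorm]
    push_cast
    calc Real.sqrt ‖z‖ ≤ Real.sqrt (A.ub : ℝ) := Real.sqrt_le_sqrt hz.norm_le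
      _ ≤ (1 + (A.ub : ℝ)) / 2 := by
        rw [Real.sqrt_le_left (by linarith)]
        nlinarith [sq_nonneg ((A.ub : ℝ) - 1)]
  have hre' : (0 : ℝ) < A.relo := by exact_mod_cast h
  have hL : ((min (max A.lb A.relo) 1 : ℚ) : ℝ) ≤ ‖z ^ (((1 : ℝ) / 2 : ℝ) : ℂ)‖ := by
    rw [hnorm]
    push_cast
    have hmax : max (A.lb : ℝ) (A.relo : ℝ) ≤ ‖z‖ :=
      max_le hz.le_norm (hz.le_re.trans (Complex.re_le_norm z))
    by_cases h1 : 1 ≤ ‖z‖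
    · calc min (max (A.lb : ℝ) (A.relo : ℝ)) 1 ≤ 1 := min_le_right _ _
        _ ≤ Real.sqrt ‖z‖ := by rw [Real.le_sqrt (by norm_num) (by linarith)]; linarith
    · have h1 := not_le.mp h1
      calc min (max (A.lb : ℝ) (A.relo : ℝ)) 1 ≤ ‖z‖ := (min_le_left _ _).trans hmax
        _ ≤ Real.sqrt ‖z‖ := by
          rw [Real.le_sqrt (norm_nonneg z) (norm_nonneg z)]
          nlinarith [norm_nonneg z]
  refine ⟨by simpa [SB.sqrtB] using hU, by simpa [SB.sqrtB] using hL, ?_, ?_⟩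
  · simp only [SB.sqrtB, Rat.cast_zero]
    rw [Complex.cpow_ofReal_re]
    refine mul_nonneg (Real.rpow_nonneg (norm_nonneg z) _) (Real.cos_nonneg_of_mem_Icc ⟨?_, ?_⟩)
    · have := Complex.neg_pi_lt_arg z
      linarith
    · have := Complex.arg_le_pi z
      linarith
  · simp only [SB.sqrtB]
    exact (Complex.re_le_norm _).trans hU

/-- Soundness of the harmonic bound: `|cos mz| ≤ cosh (m log r)` on `|Im z| < log r`.
[cite: TrefethenWeideman2014, Sect. 5 (5.2)] -/
theorem SBnd.cosN {r : ℚ} (hr : 1 < r) (m : ℕ) {z : ℂ} (hz : |z.im| < Real.log r) :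
    SBnd (Complex.cos ((m : ℂ) * z)) ⟨coshQ r m, 0, -coshQ r m, coshQ r m⟩ := by
  have hr0 : (0 : ℝ) < r := by exact_mod_cast (zero_lt_one.trans hr)
  have hcast : ((coshQ r m : ℚ) : ℝ) = Real.cosh (Real.log ((r : ℝ) ^ m)) := by
    rw [Real.cosh_log (pow_pos hr0 m)]
    unfold coshQ
    push_cast
    ring
  have him : |((m : ℂ) * z).im| ≤ Real.log ((r : ℝ) ^ m) := by
    rw [Real.log_pow]
    simp only [Complex.mul_im, Complex.natCast_re, Complex.natCast_im, zero_mul, add_zero]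
    rw [abs_mul, Nat.abs_cast]
    exact mul_le_mul_of_nonneg_left hz.le (Nat.cast_nonneg m)
  refine sbnd_of_norm ?_ (by push_cast; exact norm_nonneg _)
  rw [hcast]
  exact (norm_cos_le_cosh_im _).trans (cosh_le_cosh_of_abs_le him)

/-- `|sin mz| ≤ cosh (m log r)` on `|Im z| < log r`. [cite: TrefethenWeideman2014, Sect. 5 (5.2)] -/
theorem SBnd.sinN {r : ℚ} (hr : 1 < r) (m : ℕ) {z : ℂ} (hz : |z.im| < Real.log r) :
    SBnd (Complex.sin ((m : ℂ) * z)) ⟨coshQ r m, 0, -coshQ r m, coshQ r m⟩ := by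
  have hr0 : (0 : ℝ) < r := by exact_mod_cast (zero_lt_one.trans hr)
  have hcast : ((coshQ r m : ℚ) : ℝ) = Real.cosh (Real.log ((r : ℝ) ^ m)) := by
    rw [Real.cosh_log (pow_pos hr0 m)]
    unfold coshQ
    push_cast
    ring
  have him : |((m : ℂ) * z).im| ≤ Real.log ((r : ℝ) ^ m) := by
    rw [Real.log_pow]
    simp only [Complex.mul_im, Complex.natCast_re, Complex.natCast_im, zero_mul, add_zero]
    rw [abs_mul, Nat.abs_cast]
    exact mul_le_mul_of_nonneg_left hz.le (Nat.cast_nonneg m)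
  refine sbnd_of_norm ?_ (by push_cast; exact norm_nonneg _)
  rw [hcast]
  exact (norm_sin_le_cosh_im _).trans (cosh_le_cosh_of_abs_le him)

/-! #### The soundness theorem of the strip calculus -/

/-- **Soundness of the strip majorant calculus.**  If `ok r e` (`r > 1`), then at every point of the
strip `|Im z| < log r` the expression is complex-differentiable and its value obeys the strip data
`bnd r e`: `lb ≤ |v(z)| ≤ ub`, `relo ≤ Re v(z) ≤ rehi`. [cite: Moore1979, Thm. 3.1] -/
theorem sbnd_evalC {r : ℚ} (hr : 1 < r) :
    ∀ (e : SExpr), ok r e = true → ∀ z : ℂ, |z.im| < Real.log r →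
      SBnd (evalC e z) (bnd r e) ∧ DifferentiableAt ℂ (evalC e) z := by
  intro e
  induction e with
  | const c =>
    intro _ z _
    simp only [evalC, bnd]
    exact ⟨SBnd.const c, differentiableAt_const _⟩
  | cosN m =>
    intro _ z hz
    simp only [evalC, bnd]
    exact ⟨SBnd.cosN hr m hz, ((differentiableAt_id.const_mul (m : ℂ)).ccos)⟩
  | sinN m =>
    intro _ z hz
    simp only [evalC, bnd]
    exact ⟨SBnd.sinN hr m hz, ((differentiableAt_id.const_mul (m : ℂ)).csin)⟩
  | add e f ihe ihf =>
    intro hok z hz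
    simp only [ok, Bool.and_eq_true] at hok
    have h1 := ihe hok.1 z hz
    have h2 := ihf hok.2 z hz
    simp only [evalC, bnd]
    exact ⟨h1.1.add h2.1, h1.2.add h2.2⟩
  | sub e f ihe ihf =>
    intro hok z hz
    simp only [ok, Bool.and_eq_true] at hok
    have h1 := ihe hok.1 z hz
    have h2 := ihf hok.2 z hz
    simp only [evalC, bnd]
    exact ⟨h1.1.sub h2.1, h1.2.sub h2.2⟩
  | neg e ih =>
    intro hok z hz
    simp only [ok] at hok
    have h1 := ih hok z hz
    simp only [evalC, bnd]
    exact ⟨h1.1.neg, h1.2.neg⟩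
  | mul e f ihe ihf =>
    intro hok z hz
    simp only [ok, Bool.and_eq_true] at hok
    have h1 := ihe hok.1 z hz
    have h2 := ihf hok.2 z hz
    simp only [evalC, bnd]
    exact ⟨h1.1.mul h2.1, h1.2.mul h2.2⟩
  | exp e ih =>
    intro hok z hz
    simp only [ok] at hok
    have h1 := ih hok z hz
    simp only [evalC, bnd]
    exact ⟨h1.1.exp, h1.2.cexp⟩
  | cos e ih =>
    intro hok z hz
    simp only [ok] at hok
    have h1 := ih hok z hz
    simp only [evalC, bnd]
    exact ⟨h1.1.cos, h1.2.ccos⟩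
  | sin e ih =>
    intro hok z hz
    simp only [ok] at hok
    have h1 := ih hok z hz
    simp only [evalC, bnd]
    exact ⟨h1.1.sin, h1.2.csin⟩
  | inv e ih =>
    intro hok z hz
    simp only [ok, Bool.and_eq_true, decide_eq_true_eq] at hok
    have h1 := ih hok.1 z hz
    simp only [evalC, bnd]
    exact ⟨h1.1.inv hok.2, h1.2.inv (ne_zero_of_lb h1.1 hok.2)⟩
  | sqrt e ih =>
    intro hok z hz
    simp only [ok, Bool.and_eq_true, decide_eq_true_eq] at hok
    have h1 := ih hok.1 z hz
    simp only [evalC, bnd]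
    exact ⟨h1.1.sqrt hok.2, h1.2.cpow_const (mem_slitPlane_of_relo h1.1 hok.2)⟩

/-- Analyticity in the strip. [cite: TrefethenWeideman2014, Thm. 4.2] -/
theorem differentiableOn_evalC {r : ℚ} (hr : 1 < r) {e : SExpr} (hok : ok r e = true) :
    DifferentiableOn ℂ (evalC e) {z : ℂ | |z.im| < Real.log r} :=
  fun z hz => ((sbnd_evalC hr e hok z hz).2).differentiableWithinAt

/-- The strip bound `|v(z)| ≤ ub`. [cite: TrefethenWeideman2014, Thm. 4.2] -/
theorem norm_evalC_le {r : ℚ} (hr : 1 < r) {e : SExpr} (hok : ok r e = true) {z : ℂ}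
    (hz : |z.im| < Real.log r) : ‖evalC e z‖ ≤ (bnd r e).ub :=
  (sbnd_evalC hr e hok z hz).1.norm_le

/-- On the real axis the complex semantics is the real integrand. [cite: TrefethenWeideman2014, Thm. 4.2] -/
theorem evalC_ofReal {r : ℚ} (hr : 1 < r) :
    ∀ (e : SExpr), ok r e = true → ∀ θ : ℝ, evalC e (θ : ℂ) = ((evalR e θ : ℝ) : ℂ) := by
  have hlog : 0 < Real.log r := Real.log_pos (by exact_mod_cast hr)
  have hstrip : ∀ θ : ℝ, |(θ : ℂ).im| < Real.log r := fun θ => by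
    simpa [Complex.ofReal_im] using hlog
  intro e
  induction e with
  | const c => intro _ θ; simp only [evalC, evalR]; push_cast; rfl
  | cosN m => intro _ θ; simp only [evalC, evalR]; push_cast; rfl
  | sinN m => intro _ θ; simp only [evalC, evalR]; push_cast; rfl
  | add e f ihe ihf =>
    intro hok θ
    simp only [ok, Bool.and_eq_true] at hok
    simp only [evalC, evalR, ihe hok.1, ihf hok.2]
    push_cast
    rfl
  | sub e f ihe ihf =>
    intro hok θ
    simp only [ok, Bool.and_eq_true] at hok
    simp only [evalC, evalR, ihe hok.1, ihf hok.2]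
    push_cast
    rfl
  | neg e ih =>
    intro hok θ
    simp only [ok] at hok
    simp only [evalC, evalR, ih hok]
    push_cast
    rfl
  | mul e f ihe ihf =>
    intro hok θ
    simp only [ok, Bool.and_eq_true] at hok
    simp only [evalC, evalR, ihe hok.1, ihf hok.2]
    push_cast
    rfl
  | exp e ih =>
    intro hok θ
    simp only [ok] at hok
    simp only [evalC, evalR, ih hok]
    exact (Complex.ofReal_exp _).symm
  | cos e ih =>
    intro hok θ
    simp only [ok] at hok
    simp only [evalC, evalR, ih hok]
    exact (Complex.ofReal_cos _).symm
  | sin e ih =>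
    intro hok θ
    simp only [ok] at hok
    simp only [evalC, evalR, ih hok]
    exact (Complex.ofReal_sin _).symm
  | inv e ih =>
    intro hok θ
    simp only [ok, Bool.and_eq_true, decide_eq_true_eq] at hok
    simp only [evalC, evalR, ih hok.1]
    exact (Complex.ofReal_inv _).symm
  | sqrt e ih =>
    intro hok θ
    simp only [ok, Bool.and_eq_true, decide_eq_true_eq] at hok
    have hpos : 0 ≤ evalR e θ := by
      have h1 := (sbnd_evalC hr e hok.1 θ (hstrip θ)).1.le_re
      rw [ih hok.1, Complex.ofReal_re] at h1
      have h2 : (0 : ℝ) < (bnd r e).relo := by exact_mod_cast hok.2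
      linarith
    simp only [evalC, evalR, ih hok.1]
    rw [Real.sqrt_eq_rpow, Complex.ofReal_cpow hpos]

/-! ### Part C. The certified error bound of the `N`-point trapezoidal rule -/

/-- **The exponentially convergent trapezoidal rule, certified form.**  If `ok r e` (`r > 1`
rational), the `N`-point trapezoidal rule `I_N = (2π/N) Σ_{k<N} v(2πk/N)` of the real integrand
`v = evalR e` satisfies `|I_N - ∫_0^{2π} v| ≤ 4π·ub/(r^N - 1)` with the certified strip bound
`ub = (bnd r e).ub` — Trefethen–Weideman's `4πM/(e^{aN} - 1)` with `a = log r`, i.e. Davis–Rabinowitz's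
`2pM/(r^n - 1)` for the period `p = 2π`. [cite: TrefethenWeideman2014, Thm. 4.2]
[cite: DavisRabinowitz1984, Sect. 4.6.5 (4.6.5.7)] -/
theorem abs_trapezoid_sub_integral_le {r : ℚ} (hr : 1 < r) {e : SExpr} (hok : ok r e = true)
    {N : ℕ} (hN : N ≠ 0) :
    |2 * π / N * ∑ k ∈ Finset.range N, evalR e (2 * π * k / N) -
        ∫ θ in (0 : ℝ)..2 * π, evalR e θ| ≤ 4 * π * (bnd r e).ub / ((r : ℝ) ^ N - 1) := by
  have hr1 : (1 : ℝ) < r := by exact_mod_cast hr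
  have hr0 : (0 : ℝ) < r := zero_lt_one.trans hr1
  have ha : 0 < Real.log r := Real.log_pos hr1
  have hper : ∀ z : ℂ, evalC e (z + ((2 * π : ℝ) : ℂ)) = evalC e z := fun z => by
    push_cast
    exact evalC_add_two_pi e z
  have key := Literature.Analysis.Quadrature.norm_trapezoidal_sub_integral_le (f := evalC e)
    Real.two_pi_pos ha (differentiableOn_evalC hr hok) hper
    (fun z hz => norm_evalC_le hr hok hz) hN
  have hofR := evalC_ofReal hr e hok
  have hnodes : ∀ k : ℕ, evalC e ((k : ℂ) * ((2 * π : ℝ) : ℂ) / (N : ℂ)) =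
      ((evalR e (2 * π * k / N) : ℝ) : ℂ) := by
    intro k
    rw [← hofR]
    congr 1
    push_cast
    ring
  have hexp : Real.exp (2 * π * Real.log r * N / (2 * π)) = (r : ℝ) ^ N := by
    have h2pi : (2 * π : ℝ) ≠ 0 := by positivity
    have : 2 * π * Real.log r * N / (2 * π) = N * Real.log r := by
      rw [show 2 * π * Real.log r * N = (2 * π) * (N * Real.log r) by ring, mul_div_cancel_left₀ _ h2pi]
    rw [this, Real.exp_nat_mul, Real.exp_log hr0]
  have hC : ((2 * π / N * ∑ k ∈ Finset.range N, evalR e (2 * π * k / N) -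
        ∫ θ in (0 : ℝ)..2 * π, evalR e θ : ℝ) : ℂ) =
      ((2 * π : ℝ) : ℂ) / (N : ℂ) * ∑ k ∈ Finset.range N, evalC e (k * ((2 * π : ℝ) : ℂ) / N) -
        ∫ x in (0 : ℝ)..2 * π, evalC e x := by
    simp only [hnodes, hofR, intervalIntegral.integral_ofReal]
    push_cast
    ring
  rw [← Real.norm_eq_abs, ← Complex.norm_real, hC]
  rw [hexp] at key
  refine key.trans (le_of_eq ?_)
  ring

/-! ### Part D. The interval kernel: enclosures of the integrand at the nodes `2πk/N` -/

/-- Newton's iteration for the integer square root with fuel (its output is CHECKED by `sqrtI`,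
so no property of it is needed). [folklore] -/
private def isqrtAux (n : ℕ) : ℕ → ℕ → ℕ
  | 0, g => g
  | fuel + 1, g => if (g + n / g) / 2 < g then isqrtAux n fuel ((g + n / g) / 2) else g

/-- A candidate for `⌊√n⌋`. [folklore] -/
private def isqrt (n : ℕ) : ℕ := isqrtAux n 3000 (n + 1)

/-- Square root of an interval with nonnegative lower endpoint at scale `S`, outward rounded and
self-validating (`none` if the candidate roots fail their defining inequalities).
[cite: Moore1979, Sect. 3.3] -/
def sqrtI (S : ℕ) (I : MI) : Option MI :=
  if 0 ≤ I.lo ∧ isqrt (I.lo * S).toNat * isqrt (I.lo * S).toNat ≤ (I.lo * S).toNat ∧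
      (I.hi * S).toNat < (isqrt (I.hi * S).toNat + 1) * (isqrt (I.hi * S).toNat + 1) then
    some ⟨(isqrt (I.lo * S).toNat : ℤ), ((isqrt (I.hi * S).toNat + 1 : ℕ) : ℤ)⟩
  else none

/-- Soundness of `sqrtI`. [cite: Moore1979, Thm. 3.1] -/
theorem mem_sqrtI {S : ℕ} (hS : 0 < S) {x : ℝ} {I Y : MI} (h : sqrtI S I = some Y)
    (hx : MI.mem S x I) : MI.mem S (Real.sqrt x) Y := by
  unfold sqrtI at h
  split_ifs at h with hc
  obtain ⟨hlo, hs, ht⟩ := hc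
  simp only [Option.some.injEq] at h
  subst h
  have hSr : (0 : ℝ) < S := by exact_mod_cast hS
  obtain ⟨h1, h2⟩ := hx
  have hlo' : (0 : ℝ) ≤ I.lo := by exact_mod_cast hlo
  have hx0 : 0 ≤ x := by
    have : 0 ≤ x * S := hlo'.trans h1
    nlinarith
  have hhi : 0 ≤ I.hi * S := by
    have : (I.lo : ℝ) ≤ I.hi := h1.trans h2
    have : I.lo ≤ I.hi := by exact_mod_cast this
    have hS' : (0 : ℤ) ≤ S := by exact_mod_cast hS.le
    nlinarith
  have hloS : 0 ≤ I.lo * S := mul_nonneg hlo (by exact_mod_cast hS.le)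
  set a := (I.lo * S).toNat with ha
  set b := (I.hi * S).toNat with hb
  have haR : (a : ℝ) = (I.lo : ℝ) * S := by
    have : (a : ℤ) = I.lo * S := by rw [ha]; exact Int.toNat_of_nonneg hloS
    exact_mod_cast this
  have hbR : (b : ℝ) = (I.hi : ℝ) * S := by
    have : (b : ℤ) = I.hi * S := by rw [hb]; exact Int.toNat_of_nonneg hhi
    exact_mod_cast this
  have hsq : Real.sqrt x * S = Real.sqrt (x * S * S) := by
    rw [mul_assoc, Real.sqrt_mul hx0, Real.sqrt_mul_self hSr.le]
  constructor
  · -- lower endpoint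
    have hsR : ((isqrt a : ℕ) : ℝ) ≤ Real.sqrt a := by
      rw [Real.le_sqrt (Nat.cast_nonneg _) (Nat.cast_nonneg _)]
      exact_mod_cast (by simpa [pow_two] using hs)
    have hle : Real.sqrt (a : ℝ) ≤ Real.sqrt (x * S * S) := by
      rw [haR]
      exact Real.sqrt_le_sqrt (mul_le_mul_of_nonneg_right h1 hSr.le)
    rw [hsq]
    push_cast
    exact hsR.trans hle
  · -- upper endpoint
    have htR : Real.sqrt b < ((isqrt b + 1 : ℕ) : ℝ) := by
      rw [Real.sqrt_lt' (by positivity)]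
      exact_mod_cast (by simpa [pow_two] using ht)
    have hle : Real.sqrt (x * S * S) ≤ Real.sqrt (b : ℝ) := by
      rw [hbR]
      exact Real.sqrt_le_sqrt (mul_le_mul_of_nonneg_right h2 hSr.le)
    rw [hsq]
    push_cast at htR ⊢
    exact hle.trans htR.le

/-- Reciprocal of an interval not containing `0` (either sign). [cite: Moore1979, Sect. 3.3] -/
def invI (S : ℕ) (A : MI) : Option MI :=
  if 0 < A.lo then MI.divPos S (MI.ofInt S 1) A
  else if A.hi < 0 then
    match MI.divPos S (MI.ofInt S 1) A.neg with
    | some Y => some Y.neg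
    | none => none
  else none

/-- Soundness of `invI`. [cite: Moore1979, Thm. 3.1] -/
theorem mem_invI {S : ℕ} (hS : 0 < S) {x : ℝ} {A Y : MI} (h : invI S A = some Y)
    (hx : MI.mem S x A) : MI.mem S x⁻¹ Y := by
  have h1 : MI.mem S (1 : ℝ) (MI.ofInt S 1) := by simpa using MI.mem_ofInt S 1
  unfold invI at h
  split_ifs at h with hpos hneg
  · have := MI.mem_divPos hS h h1 hx
    simpa [one_div] using this
  · split at h
    · rename_i K hK
      simp only [Option.some.injEq] at h
      subst h
      have := MI.mem_neg (MI.mem_divPos hS hK h1 (MI.mem_neg hx))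
      have hx' : -(1 / -x) = x⁻¹ := by rw [one_div, inv_neg, neg_neg]
      rwa [hx'] at this
    · simp at h

/-- Powers of a box: `z^m`. [cite: Moore1979, Sect. 3.3] -/
def powE (S : ℕ) (E : MC) : ℕ → MC
  | 0 => MC.ofInt S 1
  | m + 1 => MC.mul S (powE S E m) E

/-- Soundness of `powE`. [cite: Moore1979, Thm. 3.1] -/
theorem mem_powE {S : ℕ} (hS : 0 < S) {z : ℂ} {E : MC} (hz : MC.mem S z E) :
    ∀ m : ℕ, MC.mem S (z ^ m) (powE S E m)
  | 0 => by simpa [powE] using MC.mem_ofInt S 1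
  | m + 1 => by
    rw [pow_succ]
    exact MC.mem_mul hS (mem_powE hS hz m) hz

/-- **The interval evaluator.**  Given the scale `S`, the Taylor parameters `K, k` of the
transcendental kernels, an enclosure `piI ∋ π` and a box `E ∋ e^{iθ}`, an enclosure of the real
integrand `v(θ)` (`none` if a reciprocal or square root cannot be certified, or a kernel declines).
The harmonics are read off the powers of `E` (`cos mθ = Re e^{imθ}`, `sin mθ = Im e^{imθ}`).
[cite: Moore1979, Sect. 4.4 (4.12)] -/
def evalMI (S K k : ℕ) (piI : MI) (E : MC) : SExpr → Option MI
  | .const c => some (MI.ofFrac S c.num c.den)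
  | .cosN m => some (powE S E m).re
  | .sinN m => some (powE S E m).im
  | .add e f =>
    match evalMI S K k piI E e, evalMI S K k piI E f with
    | some A, some B => some (A.add B)
    | _, _ => none
  | .sub e f =>
    match evalMI S K k piI E e, evalMI S K k piI E f with
    | some A, some B => some (A.sub B)
    | _, _ => none
  | .neg e =>
    match evalMI S K k piI E e with
    | some A => some A.neg
    | none => none
  | .mul e f =>
    match evalMI S K k piI E e, evalMI S K k piI E f with
    | some A, some B => some (MI.mul S A B)
    | _, _ => none
  | .exp e =>
    match evalMI S K k piI E e with
    | some A => MI.exp S K k A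
    | none => none
  | .cos e =>
    match evalMI S K k piI E e with
    | some A =>
      match MC.expI S K k piI A with
      | some W => some W.re
      | none => none
    | none => none
  | .sin e =>
    match evalMI S K k piI E e with
    | some A =>
      match MC.expI S K k piI A with
      | some W => some W.im
      | none => none
    | none => none
  | .inv e =>
    match evalMI S K k piI E e with
    | some A => invI S A
    | none => none
  | .sqrt e =>
    match evalMI S K k piI E e with
    | some A => sqrtI S A
    | none => none

/-- **Soundness of the interval evaluator** (the fundamental theorem of interval arithmetic for this
code list): `evalMI … e = some Y`, `π ∈ piI`, `e^{iθ} ∈ E` imply `v(θ) ∈ Y`. [cite: Moore1979, Thm. 3.1] -/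
theorem mem_evalMI {S K k : ℕ} (hS : 0 < S) {piI : MI} (hpi : MI.mem S Real.pi piI) {θ : ℝ}
    {E : MC} (hE : MC.mem S (Complex.exp ((θ : ℂ) * Complex.I)) E) :
    ∀ (e : SExpr) {Y : MI}, evalMI S K k piI E e = some Y → MI.mem S (evalR e θ) Y := by
  have hpow : ∀ m : ℕ, Complex.exp ((θ : ℂ) * Complex.I) ^ m =
      Complex.exp ((((m : ℝ) * θ : ℝ) : ℂ) * Complex.I) := fun m => by
    rw [← Complex.exp_nat_mul]
    congr 1
    push_cast
    ring
  intro e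
  induction e with
  | const c =>
    intro Y h
    simp only [evalMI, Option.some.injEq] at h
    subst h
    simp only [evalR]
    rw [Rat.cast_def]
    exact MI.mem_ofFrac S c.num c.den_pos
  | cosN m =>
    intro Y h
    simp only [evalMI, Option.some.injEq] at h
    subst h
    have h1 := (mem_powE hS hE m).1
    rw [hpow m, Complex.exp_ofReal_mul_I_re] at h1
    simpa [evalR] using h1
  | sinN m =>
    intro Y h
    simp only [evalMI, Option.some.injEq] at h
    subst h
    have h1 := (mem_powE hS hE m).2
    rw [hpow m, Complex.exp_ofReal_mul_I_im] at h1
    simpa [evalR] using h1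
  | add e f ihe ihf =>
    intro Y h
    simp only [evalMI] at h
    split at h
    · rename_i A B hA hB
      simp only [Option.some.injEq] at h
      subst h
      exact MI.mem_add (ihe hA) (ihf hB)
    · simp at h
  | sub e f ihe ihf =>
    intro Y h
    simp only [evalMI] at h
    split at h
    · rename_i A B hA hB
      simp only [Option.some.injEq] at h
      subst h
      exact MI.mem_sub (ihe hA) (ihf hB)
    · simp at h
  | neg e ih =>
    intro Y h
    simp only [evalMI] at h
    split at h
    · rename_i A hA
      simp only [Option.some.injEq] at h
      subst h
      exact MI.mem_neg (ih hA)
    · simp at h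
  | mul e f ihe ihf =>
    intro Y h
    simp only [evalMI] at h
    split at h
    · rename_i A B hA hB
      simp only [Option.some.injEq] at h
      subst h
      exact MI.mem_mul hS (ihe hA) (ihf hB)
    · simp at h
  | exp e ih =>
    intro Y h
    simp only [evalMI] at h
    split at h
    · rename_i A hA
      exact MI.mem_exp hS h (ih hA)
    · simp at h
  | cos e ih =>
    intro Y h
    simp only [evalMI] at h
    split at h
    · rename_i A hA
      split at h
      · rename_i W hW
        simp only [Option.some.injEq] at h
        subst h
        have h1 := (MC.mem_expI hS hpi hW (ih hA)).1
        rw [Complex.exp_ofReal_mul_I_re] at h1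
        simpa [evalR] using h1
      · simp at h
    · simp at h
  | sin e ih =>
    intro Y h
    simp only [evalMI] at h
    split at h
    · rename_i A hA
      split at h
      · rename_i W hW
        simp only [Option.some.injEq] at h
        subst h
        have h1 := (MC.mem_expI hS hpi hW (ih hA)).2
        rw [Complex.exp_ofReal_mul_I_im] at h1
        simpa [evalR] using h1
      · simp at h
    · simp at h
  | inv e ih =>
    intro Y h
    simp only [evalMI] at h
    split at h
    · rename_i A hA
      exact mem_invI hS h (ih hA)
    · simp at h
  | sqrt e ih =>
    intro Y h
    simp only [evalMI] at h
    split at h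
    · rename_i A hA
      exact mem_sqrtI hS h (ih hA)
    · simp at h

/-- The node `2πj/N` as an interval. [cite: TrefethenWeideman2014, Thm. 4.2] -/
def node (piI : MI) (N j : ℕ) : MI := (piI.mulInt (2 * (j : ℤ))).divNat N

/-- Soundness of `node`. [cite: Moore1979, Thm. 3.1] -/
theorem mem_node {S : ℕ} {piI : MI} (hpi : MI.mem S Real.pi piI) {N : ℕ} (hN : 0 < N) (j : ℕ) :
    MI.mem S (2 * π * j / N) (node piI N j) := by
  have := MI.mem_divNat (MI.mem_mulInt hpi (2 * (j : ℤ))) hN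
  unfold node
  convert this using 2
  push_cast
  ring

/-- The trapezoidal sum `Σ_{i<j} v(2πi/N)` in interval arithmetic: at each node the box
`E ∋ e^{iθ}` is computed once (`MC.expI`) and the expression evaluated by `evalMI`.
[cite: TrefethenWeideman2014, Sect. 4 (4.2)] -/
def trapSum (S K k : ℕ) (piI : MI) (N : ℕ) (e : SExpr) : ℕ → Option MI
  | 0 => some (MI.ofInt S 0)
  | j + 1 =>
    match trapSum S K k piI N e j, MC.expI S K k piI (node piI N j) with
    | some acc, some E =>
      match evalMI S K k piI E e with
      | some Y => some (acc.add Y)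
      | none => none
    | _, _ => none

/-- Soundness of `trapSum`. [cite: Moore1979, Thm. 3.1] -/
theorem mem_trapSum {S K k : ℕ} (hS : 0 < S) {piI : MI} (hpi : MI.mem S Real.pi piI) {N : ℕ}
    (hN : 0 < N) (e : SExpr) :
    ∀ (j : ℕ) {T : MI}, trapSum S K k piI N e j = some T →
      MI.mem S (∑ i ∈ Finset.range j, evalR e (2 * π * i / N)) T
  | 0, T, h => by
    simp only [trapSum, Option.some.injEq] at h
    subst h
    simpa using MI.mem_ofInt S 0
  | j + 1, T, h => by
    simp only [trapSum] at h
    split at h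
    · rename_i acc E hacc hE
      split at h
      · rename_i Y hY
        simp only [Option.some.injEq] at h
        subst h
        rw [Finset.sum_range_succ]
        exact MI.mem_add (mem_trapSum hS hpi hN e j hacc)
          (mem_evalMI hS hpi (MC.mem_expI hS hpi hE (mem_node hpi hN j)) e hY)
      · simp at h
    · simp at h

/-- The certificate data: the enclosure `IN ∋ I_N·S` of the trapezoidal value and
`err ∋ 4π·ub/(r^N - 1)·S` of the error radius (`none` if a kernel declines).
[cite: TrefethenWeideman2014, Thm. 4.2] -/
def trapData (e : SExpr) (r : ℚ) (S K k N : ℕ) : Option (MI × MI) :=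
  match MI.pi S K with
  | none => none
  | some piI =>
    match trapSum S K k piI N e N with
    | none => none
    | some T =>
      some ((MI.mul S (piI.mulInt 2) T).divNat N,
        MI.mul S (piI.mulInt 4)
          (MI.ofFrac S ((bnd r e).ub / (r ^ N - 1)).num ((bnd r e).ub / (r ^ N - 1)).den))

/-- **The certificate.**  `trapCheck e r S K k N lo hi` checks, by integer arithmetic only: `r > 1`,
the side conditions `ok r e`, `N, S > 0`, and that the interval `I_N ± 4π·ub/(r^N - 1)` computed at
scale `S` lies inside `[lo, hi]`. [cite: TrefethenWeideman2014, Thm. 4.2] -/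
def trapCheck (e : SExpr) (r : ℚ) (S K k N : ℕ) (lo hi : ℚ) : Bool :=
  decide (1 < r) && ok r e && decide (0 < N) && decide (0 < S) &&
    match trapData e r S K k N with
    | none => false
    | some D =>
      decide (lo.num * (S : ℤ) ≤ (D.1.lo - D.2.hi) * (lo.den : ℤ)) &&
        decide ((D.1.hi + D.2.hi) * (hi.den : ℤ) ≤ hi.num * (S : ℤ))

/-- **Kernel-checked enclosure of a periodic integral.**  One `decide` of `trapCheck` proves
`lo ≤ ∫_0^{2π} v(θ) dθ ≤ hi` for the real integrand `v = evalR e` — the trapezoidal value in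
outward-rounded interval arithmetic plus the certified exponentially small error
`4π·ub/(r^N - 1)` of Part C. [cite: TrefethenWeideman2014, Thm. 4.2]
[cite: DavisRabinowitz1984, Sect. 4.6.5 (4.6.5.7)] -/
theorem integral_mem_of_trapCheck {e : SExpr} {r : ℚ} {S K k N : ℕ} {lo hi : ℚ}
    (h : trapCheck e r S K k N lo hi = true) :
    (lo : ℝ) ≤ ∫ θ in (0 : ℝ)..2 * π, evalR e θ ∧ ∫ θ in (0 : ℝ)..2 * π, evalR e θ ≤ (hi : ℝ) := by
  unfold trapCheck at h
  simp only [Bool.and_eq_true, decide_eq_true_eq] at h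
  obtain ⟨⟨⟨⟨hr, hok⟩, hN⟩, hS⟩, hrest⟩ := h
  split at hrest
  · simp at hrest
  · rename_i D hD
    simp only [Bool.and_eq_true, decide_eq_true_eq] at hrest
    obtain ⟨h1, h2⟩ := hrest
    unfold trapData at hD
    split at hD
    · simp at hD
    · rename_i piI hpiEq
      split at hD
      · simp at hD
      · rename_i T hT
        simp only [Option.some.injEq] at hD
        subst hD
        dsimp only at h1 h2
        -- the real quantities
        set Sr : ℝ := ∑ i ∈ Finset.range N, evalR e (2 * π * i / N) with hSr_def
        set IN : ℝ := 2 * π / N * Sr with hINdef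
        set I : ℝ := ∫ θ in (0 : ℝ)..2 * π, evalR e θ with hIdef
        set q : ℚ := (bnd r e).ub / (r ^ N - 1) with hq
        set ε : ℝ := 4 * π * (bnd r e).ub / ((r : ℝ) ^ N - 1) with hε
        have hSr : (0 : ℝ) < S := by exact_mod_cast hS
        have hpi := MI.mem_pi S hpiEq
        have hsum := mem_trapSum hS hpi hN e N hT
        have hIN : MI.mem S IN ((MI.mul S (piI.mulInt 2) T).divNat N) := by
          have := MI.mem_divNat (MI.mem_mul hS (MI.mem_mulInt hpi 2) hsum) hN
          convert this using 2
          rw [hINdef]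
          push_cast
          ring
        have hqR : (q : ℝ) = ((bnd r e).ub : ℝ) / ((r : ℝ) ^ N - 1) := by
          rw [hq]
          push_cast
          ring
        have herr : MI.mem S ε (MI.mul S (piI.mulInt 4) (MI.ofFrac S q.num q.den)) := by
          have := MI.mem_mul hS (MI.mem_mulInt hpi 4) (MI.mem_ofFrac S q.num q.den_pos)
          rw [← Rat.cast_def] at this
          convert this using 2
          rw [hε, hqR]
          push_cast
          ring
        have habs := abs_trapezoid_sub_integral_le hr hok hN.ne'
        rw [← hSr_def, ← hINdef, ← hIdef, ← hε, abs_le] at habs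
        obtain ⟨hA1, hA2⟩ := hIN
        obtain ⟨hB1, hB2⟩ := herr
        have h1r : (lo.num : ℝ) * S ≤
            ((((MI.mul S (piI.mulInt 2) T).divNat N).lo : ℝ) -
              (MI.mul S (piI.mulInt 4) (MI.ofFrac S q.num q.den)).hi) * lo.den := by
          exact_mod_cast h1
        have h2r : ((((MI.mul S (piI.mulInt 2) T).divNat N).hi : ℝ) +
              (MI.mul S (piI.mulInt 4) (MI.ofFrac S q.num q.den)).hi) * hi.den ≤
            hi.num * S := by
          exact_mod_cast h2
        have hdlo : (0 : ℝ) < lo.den := by exact_mod_cast lo.den_pos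
        have hdhi : (0 : ℝ) < hi.den := by exact_mod_cast hi.den_pos
        constructor
        · have keylo : (lo.num : ℝ) * S ≤ I * lo.den * S := by
            calc (lo.num : ℝ) * S
                ≤ ((((MI.mul S (piI.mulInt 2) T).divNat N).lo : ℝ) -
                    (MI.mul S (piI.mulInt 4) (MI.ofFrac S q.num q.den)).hi) * lo.den := h1r
              _ ≤ (IN - ε) * S * lo.den := by
                  apply mul_le_mul_of_nonneg_right _ hdlo.le
                  linarith
              _ ≤ I * S * lo.den := by
                  apply mul_le_mul_of_nonneg_right _ hdlo.le
                  apply mul_le_mul_of_nonneg_right _ hSr.le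
                  linarith
              _ = I * lo.den * S := by ring
          have keylo' : (lo.num : ℝ) ≤ I * lo.den := le_of_mul_le_mul_right keylo hSr
          rw [Rat.cast_def, div_le_iff₀ hdlo]
          exact keylo'
        · have keyhi : I * hi.den * S ≤ (hi.num : ℝ) * S := by
            calc I * hi.den * S = I * S * hi.den := by ring
              _ ≤ (IN + ε) * S * hi.den := by
                  apply mul_le_mul_of_nonneg_right _ hdhi.le
                  apply mul_le_mul_of_nonneg_right _ hSr.le
                  linarith
              _ ≤ ((((MI.mul S (piI.mulInt 2) T).divNat N).hi : ℝ) +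
                    (MI.mul S (piI.mulInt 4) (MI.ofFrac S q.num q.den)).hi) * hi.den := by
                  apply mul_le_mul_of_nonneg_right _ hdhi.le
                  linarith
              _ ≤ hi.num * S := h2r
          have keyhi' : I * hi.den ≤ (hi.num : ℝ) := le_of_mul_le_mul_right keyhi hSr
          rw [Rat.cast_def, le_div_iff₀ hdhi]
          exact keyhi'

end PeriodicTrapezoid

end Literature.Analysis.ValidatedNumerics
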